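import Literature.Computability.QuantumComplexity.ADHCoWalk
import Literature.Computability.QuantumComplexity.BQPSubsetPP
import Literature.Computability.QuantumComplexity.GapPRing
import HarnessLib

/-!
# `BQP ⊆ AWPP`: the two witness languages and their counts

Counting half of the proof of the named fact
`Literature.Computability.QuantumComplexity.BQP_subset_AWPP` (`CountingSimulation.lean`;
Fortnow–Rogers 1999, Thm. 3.1 with Lemma 3.2, in Fenner's one-`GapP`-function form of `AWPP`,
Fenner 2003, Cor. 3.2). Fortnow–Rogers prove `BQP ⊆ AWPP` by exhibiting a `GapP` function `f` with
`Pr[M accepts x] = f(x)/5^{2t(|x|)}` for a machine with rational amplitudes (Lemma 3.2, via the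
path sums of Adleman–DeMarrais–Huang) and then normalising the denominator. For the tree's `BQP`
(uniform Clifford+`T` circuits, amplitudes in `ℤ[ω]/√2^h`) the acceptance probability is in general
irrational; the substitute is the integer path-pair count `W = 4𝔄 + 3𝔅` of
`CliffordTPathSums.lean`, for which `1/2 + W/(8·2^h)` is the acceptance probability up to
`(3√2 - 4)/8` (`h` = number of Hadamard gates). This file realises
`x ↦ W(x) · 2^{p'(|x|) - 2 - h(x)}` as a difference of two `#P` counts, reusing the
Adleman–DeMarrais–Huang predicate `adhLang F ∈ P` of `BQPSubsetPP.lean` (whose accepted guesses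
`b b' c u` number `2^{|u|}(4·4^μ + W)`, `cnt_adhLang`) behind two polynomial-time filters on the
guess string `y = u z b b' c …` of polynomial length:

* the **co-validity** of the first block `u ∈ {0,1}^μ` (`ADHCoWalk.lean`: `2^{μ-h}` accepted
  values — the factor `2^{-h}`);
* a **zero tail** inside the next block `z` of polynomial length `K(|x|)`: after two walks' worth
  of free coins the rest of `z` is `0…0` (`2^{2μ}` accepted values out of `2^{K}` — this cancels the
  `4^μ` of the pair space against the polynomial length).

Contents: membership of `⟨x, y⟩` in the three filter languages (written out as preimages under the
`FP` maps of `ADHCoWalk.lean` and `CoinTruncation.lean`; no definitions are introduced, the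
languages are local to the proofs as in `CountingGapPProofs.lean`), the block counting lemmas
`cnt_filter_block`, `cnt_zeroTail`, the filtered count `cnt_filtered` (`= 2^{μ-h} · 2^{2μ} · #A`
for any language `A` behind filters with the stated membership), and the summary
**`exists_gapPair`**: two languages `L₁, L₂ ∈ P` with
`#L₁(x) - #L₂(x) = 2^{μ-h} · 2^{2μ} · 2^{f+1} · W(x)`. The `GapP` assembly, the error estimate and
the amplification are in `BQPSubsetAWPP.lean`.

## References

* L. Fortnow, J. Rogers, *Complexity limitations on quantum computation*, J. Comput. System Sci.
  59 (1999) 240–252, §3: Thm. 3.1 (`BQP ⊆ AWPP`), Lemma 3.2 (the `GapP` function of a quantum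
  machine), arXiv:cs/9811023 (p. 6).
* S. Fenner, *PP-lowness and a simple definition of AWPP*, Theory Comput. Syst. 36 (2003)
  199–212, Thm. 1.2 / Cor. 3.2.
* L. M. Adleman, J. DeMarrais, M.-D. A. Huang, *Quantum computability*, SIAM J. Comput. 26
  (1997), §6, Lemma 6.10 (path-pair counting).
-/

noncomputable section

namespace Literature.Computability.QuantumComplexity

open _root_.Computability Polynomial Complexity Complexity.Classes Complexity.Brick Cryptography ADH
  Literature.Computability.Complexity.TTClosure Literature.Computability.Complexity.PPSharpP GapPRing

namespace AWPPBQP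

variable (F : QCircuitFamily cliffordT) (K : Polynomial ℕ)

/-! ### Membership in the three filters -/

/-- **Co-validity filter**: `⟨x, y⟩` passes iff the first `μ` coins of `y` are co-valid along the
`|x|`-th circuit (coin `0` at every Hadamard gate). [folklore] -/
theorem mem_coFilter_iff (hF : F.IsOracleFree) (x y : List Bool) :
    boolPair x y ∈ (coFlagF F ⁻¹' HasBit true : Language Bool) ↔ coValid (F.circ x.length).gates y = true := by
  show coFlagF F (boolPair x y) ∈ HasBit true ↔ _
  rw [coFlagF_boolPair F hF x y, mem_HasBit]
  simp

/-- **Zero-tail filter**: `⟨x, y⟩` passes iff, in the block of the `K(|x|)` coins following the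
first `μ`, the coins after the first `2μ` are all `0`. [folklore] -/
theorem mem_zeroFilter_iff (hF : F.IsOracleFree) (x y : List Bool) :
    boolPair x y ∈ ((sndF ∘ dropWalkF F ∘ dropWalkF F ∘ truncSndFn K ∘ dropWalkF F) ⁻¹' NoBit true : Language Bool) ↔
      true ∉ ((((y.drop (F.circ x.length).gates.length).take (K.eval x.length)).drop
        (F.circ x.length).gates.length).drop (F.circ x.length).gates.length) := by
  show (sndF ∘ dropWalkF F ∘ dropWalkF F ∘ truncSndFn K ∘ dropWalkF F) (boolPair x y) ∈ NoBit true ↔ _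
  simp only [Function.comp_apply, dropWalkF_boolPair F hF, truncSndFn_boolPair, sndF_boolPair, mem_NoBit]

/-- **The shifted language**: `⟨x, y⟩` passes iff `⟨x, y ⇂ (μ + K(|x|))⟩ ∈ A`. [folklore] -/
theorem mem_shift_iff (hF : F.IsOracleFree) (A : Language Bool) (x y : List Bool) :
    boolPair x y ∈ ((dropSndFn K ∘ dropWalkF F) ⁻¹' A : Language Bool) ↔
      boolPair x ((y.drop (F.circ x.length).gates.length).drop (K.eval x.length)) ∈ A := by
  show (dropSndFn K ∘ dropWalkF F) (boolPair x y) ∈ A ↔ _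
  simp only [Function.comp_apply, dropWalkF_boolPair F hF, dropSndFn_boolPair]

/-! ### Counting lemmas -/

/-- **A filter on the first block scales the count**: if membership of `u y'` (`|u| = a`) is
"`T u` and `y' ∈ E`", the count over length `a + b` is `#{u | T u} · cnt b E`. [folklore] -/
theorem cnt_filter_block (a b : ℕ) (T : List Bool → Bool) (E S : Set (List Bool))
    (hS : ∀ u y' : List Bool, u.length = a → (u ++ y' ∈ S ↔ T u = true ∧ y' ∈ E)) :
    cnt (a + b) S = cnt a {u | T u = true} * cnt b E := by
  rw [← cnt_take_drop]
  refine cnt_congr fun y hy => ?_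
  have h := hS (y.take a) (y.drop a) (by rw [List.length_take]; omega)
  rw [List.take_append_drop] at h
  simpa using h

/-- **The zero-tail block**: of the strings `z ∈ {0,1}^{2μ + r}`, exactly `2^{2μ}` have no `1`
after the first `2μ` symbols. [folklore] -/
theorem cnt_zeroTail (μ r : ℕ) :
    cnt (μ + μ + r) {z | true ∉ (z.drop μ).drop μ} = 2 ^ (μ + μ) := by
  have h := cnt_take_drop (μ + μ) r Set.univ {t | true ∉ t}
  rw [cnt_univ, cnt_noTrue, mul_one] at h
  rw [← h]
  refine cnt_congr fun z _ => ?_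
  simp only [Set.mem_setOf_eq, Set.mem_univ, true_and, List.drop_drop]

/-! ### The filtered count -/

section Counts

variable {F}

/-- **The filtered count.** Let `Co`, `Zt`, `Sh` be languages whose membership of `⟨x, y⟩` is,
respectively, the co-validity of the first `μ` coins of `y` along `gs` (`μ = |gs|`, `h` Hadamard
gates), the absence of `1` in the block of `K = 2μ + r` coins following the first `μ` after two
more walks' worth of coins, and `⟨x, y ⇂ (μ + K)⟩ ∈ A`. Then over guesses of length `μ + K + m` the
language `Co ⊓ Zt ⊓ Sh` has `2^{μ-h} · 2^{2μ} · #{y'' ∈ {0,1}^m | ⟨x, y''⟩ ∈ A}` members.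
[cite: FortnowRogers1999JCSS, Lemma 3.2 (the GapP function f)] -/
theorem cnt_filtered {N : ℕ} (gs : List (QGate cliffordT N)) (x : List Bool) (Kx r m : ℕ)
    (hK : Kx = gs.length + gs.length + r) (Co Zt Sh A : Language Bool)
    (hCo : ∀ y : List Bool, boolPair x y ∈ Co ↔ coValid gs y = true)
    (hZt : ∀ y : List Bool, boolPair x y ∈ Zt ↔
      true ∉ ((((y.drop gs.length).take Kx).drop gs.length).drop gs.length))
    (hSh : ∀ y : List Bool, boolPair x y ∈ Sh ↔ boolPair x ((y.drop gs.length).drop Kx) ∈ A) :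
    cnt (gs.length + (Kx + m)) {y | boolPair x y ∈ Co ⊓ (Zt ⊓ Sh)} =
      2 ^ (gs.length - hCount gs) * (2 ^ (gs.length + gs.length) * cnt m {y'' | boolPair x y'' ∈ A}) := by
  set μ := gs.length with hμ
  -- the co-validity block
  have step1 : cnt (μ + (Kx + m)) {y | boolPair x y ∈ Co ⊓ (Zt ⊓ Sh)} =
      cnt μ {u | coValid gs u = true} *
        cnt (Kx + m) {y' | y'.take Kx ∈ {z : List Bool | true ∉ (z.drop μ).drop μ} ∧
          y'.drop Kx ∈ {y'' | boolPair x y'' ∈ A}} := by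
    refine cnt_filter_block μ _ (coValid gs) _ _ fun u y' hu => ?_
    simp only [Set.mem_setOf_eq]
    rw [Language.mem_inf, Language.mem_inf, hCo, hZt, hSh, coValid_append gs u y' (by omega),
      List.drop_left' hu]
  -- the zero-tail block
  have step2 : cnt (Kx + m) {y' | y'.take Kx ∈ {z : List Bool | true ∉ (z.drop μ).drop μ} ∧
      y'.drop Kx ∈ {y'' | boolPair x y'' ∈ A}} = 2 ^ (μ + μ) * cnt m {y'' | boolPair x y'' ∈ A} := by
    rw [cnt_take_drop, hK, cnt_zeroTail]
  rw [step1, step2, cnt_coValid gs]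

/-- The rejected guesses of the ADH predicate: `#{y'' | ⟨x, y''⟩ ∉ adhLang F} = 2^{2μ+3+f} - 2^f(4·4^μ + W)`.
[cite: AdlemanDeMarraisHuang1997, §6 Lemma 6.10 (proof, p. 1539: the number of yes outputs minus the number of no outputs)] -/
theorem cnt_compl_adhLang (hF : F.IsOracleFree) (x : List Bool) (f : ℕ) :
    (cnt ((F.circ x.length).gates.length + ((F.circ x.length).gates.length + (3 + f)))
      {y'' | boolPair x y'' ∈ (adhLang F)ᶜ} : ℤ) =
      2 ^ ((F.circ x.length).gates.length + ((F.circ x.length).gates.length + (3 + f))) -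
        2 ^ f * (4 * (2 ^ (F.circ x.length).gates.length * 2 ^ (F.circ x.length).gates.length) +
          adhW (F.circ x.length).gates (w₀ F x)) := by
  set μ := (F.circ x.length).gates.length with hμ
  have h := cnt_add_cnt_compl (μ + (μ + (3 + f))) {y'' | boolPair x y'' ∈ adhLang F}
  have hc : cnt (μ + (μ + (3 + f))) ({y'' | boolPair x y'' ∈ adhLang F}ᶜ) =
      cnt (μ + (μ + (3 + f))) {y'' | boolPair x y'' ∈ (adhLang F)ᶜ} := cnt_congr fun y _ => Iff.rfl
  rw [hc] at h
  have h' : ((cnt (μ + (μ + (3 + f))) {y'' | boolPair x y'' ∈ adhLang F} : ℕ) : ℤ) +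
      ((cnt (μ + (μ + (3 + f))) {y'' | boolPair x y'' ∈ (adhLang F)ᶜ} : ℕ) : ℤ) =
        ((2 ^ (μ + (μ + (3 + f))) : ℕ) : ℤ) := by exact_mod_cast h
  push_cast at h'
  rw [← cnt_adhLang hF x f, ← hμ]
  linarith

/-- **The two witness languages.** For an oracle-free uniform family `F` and a polynomial `K`
there are `L₁, L₂ ∈ P` (the ADH language and its complement behind the co-validity and zero-tail
filters) such that, whenever `K(|x|) ≥ 2μ`, over guesses of length `μ + K(|x|) + 2μ + 3 + f`:
`#L₁(x) - #L₂(x) = 2^{μ-h} · 2^{2μ} · 2^{f+1} · W(x)` — the path-pair count `W` scaled by a power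
of two whose exponent no longer involves the pair space `4^μ`. [cite: FortnowRogers1999JCSS, Thm. 3.1 and Lemma 3.2 (the GapP function f with Pr[M accepts x] = f(x)/g(x))] -/
theorem exists_gapPair (hF : F.IsOracleFree) (hU : F.IsUniform) (K : Polynomial ℕ) :
    ∃ L₁ L₂ : Language Bool, L₁ ∈ Classes.P ∧ L₂ ∈ Classes.P ∧
      ∀ (x : List Bool) (r f : ℕ),
        K.eval x.length = (F.circ x.length).gates.length + (F.circ x.length).gates.length + r →
        (cnt ((F.circ x.length).gates.length + (K.eval x.length +
            ((F.circ x.length).gates.length + ((F.circ x.length).gates.length + (3 + f)))))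
          {y | boolPair x y ∈ L₁} : ℤ) -
        (cnt ((F.circ x.length).gates.length + (K.eval x.length +
            ((F.circ x.length).gates.length + ((F.circ x.length).gates.length + (3 + f)))))
          {y | boolPair x y ∈ L₂} : ℤ) =
        2 ^ ((F.circ x.length).gates.length - hCount (F.circ x.length).gates) *
          2 ^ ((F.circ x.length).gates.length + (F.circ x.length).gates.length) * 2 ^ (f + 1) *
            adhW (F.circ x.length).gates (w₀ F x) := by
  -- the three filters and the two shifted ADH languages
  set Co : Language Bool := coFlagF F ⁻¹' HasBit true with hCo
  set Zt : Language Bool := (sndF ∘ dropWalkF F ∘ dropWalkF F ∘ truncSndFn K ∘ dropWalkF F) ⁻¹' NoBit true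
    with hZt
  set Sh : Language Bool := (dropSndFn K ∘ dropWalkF F) ⁻¹' adhLang F with hSh
  set Sh' : Language Bool := (dropSndFn K ∘ dropWalkF F) ⁻¹' (adhLang F)ᶜ with hSh'
  have hCoP : Co ∈ Classes.P := preimage_mem_P (HasBit_mem_P true) (coFlagF_mem_FP F hU)
  have hZtP : Zt ∈ Classes.P :=
    preimage_mem_P (NoBit_mem_P true) (comp_mem_FP sndF_mem_FP (comp_mem_FP (dropWalkF_mem_FP F hU)
      (comp_mem_FP (dropWalkF_mem_FP F hU) (comp_mem_FP (truncSndFn_mem_FP K) (dropWalkF_mem_FP F hU)))))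
  have hShP : Sh ∈ Classes.P :=
    preimage_mem_P (adhLang_mem_P F hU) (comp_mem_FP (dropSndFn_mem_FP K) (dropWalkF_mem_FP F hU))
  have hSh'P : Sh' ∈ Classes.P :=
    preimage_mem_P ((compl_mem_P_iff (L := adhLang F)).2 (adhLang_mem_P F hU))
      (comp_mem_FP (dropSndFn_mem_FP K) (dropWalkF_mem_FP F hU))
  refine ⟨Co ⊓ (Zt ⊓ Sh), Co ⊓ (Zt ⊓ Sh'), inter_mem_P hCoP (inter_mem_P hZtP hShP),
    inter_mem_P hCoP (inter_mem_P hZtP hSh'P), fun x r f hK => ?_⟩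
  have eCo : ∀ y : List Bool, boolPair x y ∈ Co ↔ coValid (F.circ x.length).gates y = true :=
    fun y => mem_coFilter_iff F hF x y
  have eZt : ∀ y : List Bool, boolPair x y ∈ Zt ↔
      true ∉ ((((y.drop (F.circ x.length).gates.length).take (K.eval x.length)).drop
        (F.circ x.length).gates.length).drop (F.circ x.length).gates.length) :=
    fun y => mem_zeroFilter_iff F K hF x y
  have eSh : ∀ y : List Bool, boolPair x y ∈ Sh ↔
      boolPair x ((y.drop (F.circ x.length).gates.length).drop (K.eval x.length)) ∈ adhLang F :=
    fun y => mem_shift_iff F K hF (adhLang F) x y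
  have eSh' : ∀ y : List Bool, boolPair x y ∈ Sh' ↔
      boolPair x ((y.drop (F.circ x.length).gates.length).drop (K.eval x.length)) ∈ (adhLang F)ᶜ :=
    fun y => mem_shift_iff F K hF (adhLang F)ᶜ x y
  rw [cnt_filtered (F.circ x.length).gates x (K.eval x.length) r _ hK Co Zt Sh (adhLang F) eCo eZt eSh,
    cnt_filtered (F.circ x.length).gates x (K.eval x.length) r _ hK Co Zt Sh' (adhLang F)ᶜ eCo eZt eSh']
  push_cast
  rw [cnt_adhLang hF x f, cnt_compl_adhLang hF x f]
  ring

end Counts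

end AWPPBQP

end Literature.Computability.QuantumComplexity

end
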